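import Summits.BirchSwinnertonDyer.BirchSwinnertonDyer.Theses.FrozenTwin
import Literature.NumberTheory.EllipticCurves.SerreOpenImageFinalProofs
import Literature.NumberTheory.EllipticCurves.SupersingularDensityProofs
import Literature.NumberTheory.EllipticCurves.ComplexMultiplicationRationalJIntegralProofs
import Literature.NumberTheory.EllipticCurves.PAdicHeightsProofs
import Literature.NumberTheory.EllipticCurves.BSDSelmerSkinnerThmBProofs

/-!
# Non-vacuity of the hypothesis block of `UBPotentiallyGood` (stmt-BirchSwinnertonDyer-15878), in Lean

The crux quantifies over `W` elliptic and globally minimal WITH NO PRIME OF MULTIPLICATIVE REDUCTION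
and a prime `p ≥ 5` of good ordinary reduction with surjective mod-`p` representation. The sibling
crux `SelmerRankUB` (stmt-0130) was inhabited with `37a1`, which is multiplicative at `37`; here we
need a non-CM curve all of whose bad primes are ADDITIVE. Witness: `W121 : y² + y = x³ − x² − 40x − 221`
(`= 11a3 ⊗ χ₋₁₁`, conductor `121`, `Δ = −11⁷`, `c₄ = 1936 = 2⁴·11²`, `j = −4096/11`):
* non-CM: `‖j‖₁₁ = 11 > 1` (`not_hasCM_of_one_lt_norm_j`) — the sector is NOT "integral `j`";
* no multiplicative prime: at `q ≠ 11`, `‖j‖_q ≤ 1` contradicts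
  `one_lt_norm_j_of_hasMultiplicativeReductionAtPrime`; at `q = 11`, a multiplicative `ℤ₁₁`-minimal
  model `u • W121` would have unit `c₄ = u⁻⁴ · 1936`, i.e. `‖u⁻¹‖₁₁⁴ = 11²`, impossible for
  `‖u⁻¹‖₁₁ ∈ 11^ℤ` (the reduction at `11` is additive, Kodaira `I₁*`... potentially multiplicative);
* the big-image good ordinary prime comes from Serre's open image theorem + infinitude of good
  ordinary primes, both PROVED in tree, applied to a global minimal model `C • W121`
  (`hasGlobalMinimalModel_rat_holds`; multiplicative reduction is model-independent,
  `hasMultiplicativeReductionAtPrime_smul_iff`).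
-/

set_option linter.dupNamespace false

namespace Summit.BirchSwinnertonDyer.BirchSwinnertonDyer.Cruxes.UBPotentiallyGood.CruxAttack

open Summit.BirchSwinnertonDyer.BirchSwinnertonDyer
open Literature.NumberTheory.EllipticCurves
open IsDedekindDomain

/-- `121.? = 11a3 ⊗ χ₋₁₁`: `y² + y = x³ − x² − 40x − 221`. [folklore] -/
def W121 : WeierstrassCurve ℚ := ⟨0, -1, 1, -40, -221⟩

theorem W121_c₄ : W121.c₄ = 1936 := by
  norm_num [W121, WeierstrassCurve.c₄, WeierstrassCurve.b₂, WeierstrassCurve.b₄]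

theorem W121_Δ : W121.Δ = -19487171 := by
  norm_num [W121, WeierstrassCurve.Δ, WeierstrassCurve.b₂, WeierstrassCurve.b₄, WeierstrassCurve.b₆,
    WeierstrassCurve.b₈]

instance W121_isElliptic : W121.IsElliptic := ⟨by rw [W121_Δ]; norm_num⟩

theorem W121_j : W121.j = -4096 / 11 := by
  rw [WeierstrassCurve.j, Units.val_inv_eq_inv_val, WeierstrassCurve.coe_Δ', W121_c₄, W121_Δ]
  norm_num

instance fact_prime_11 : Fact (Nat.Prime 11) := ⟨by norm_num⟩

/-- `‖j(W121)‖₁₁ = 11 > 1`. [folklore] -/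
theorem one_lt_norm_j_eleven : 1 < ‖((-4096 / 11 : ℚ) : ℚ_[11])‖ := by
  rw [Padic.eq_padicNorm, padicNorm.div, padicNorm.neg]
  have h1 : padicNorm 11 (4096 : ℚ) = 1 := by
    have : ¬ 11 ∣ 4096 := by norm_num
    exact_mod_cast (padicNorm.nat_eq_one_iff 4096).2 this
  have h2 : padicNorm 11 (11 : ℚ) = (11 : ℚ)⁻¹ := by
    exact_mod_cast padicNorm.padicNorm_p_of_prime (p := 11)
  rw [h1, h2]
  norm_num

/-- `‖j(W121)‖_q ≤ 1` for every prime `q ≠ 11`. [folklore] -/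
theorem norm_j_le_one {q : ℕ} [hq : Fact q.Prime] (h11 : q ≠ 11) :
    ‖((-4096 / 11 : ℚ) : ℚ_[q])‖ ≤ 1 := by
  rw [Padic.eq_padicNorm, padicNorm.div, padicNorm.neg]
  have h1 : padicNorm q (4096 : ℚ) ≤ 1 := by exact_mod_cast padicNorm.of_nat (p := q) 4096
  have h2 : padicNorm q (11 : ℚ) = 1 := by
    have : ¬ q ∣ 11 := fun hd =>
      h11 ((Nat.prime_dvd_prime_iff_eq hq.out (by norm_num)).mp hd)
    exact_mod_cast (padicNorm.nat_eq_one_iff (p := q) 11).2 this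
  rw [h2, div_one]
  exact_mod_cast h1

/-- **`W121` has no prime of multiplicative reduction.** [folklore] -/
theorem W121_not_hasMultiplicativeReductionAtPrime (q : ℕ) [hq : Fact q.Prime] :
    ¬ W121.HasMultiplicativeReductionAtPrime q := by
  intro hmulq
  by_cases h11 : q ≠ 11
  · -- `q ≠ 11`: multiplicative reduction forces `‖j‖_q > 1`, but `‖-4096/11‖_q ≤ 1`
    have h := WeierstrassCurve.one_lt_norm_j_of_hasMultiplicativeReductionAtPrime hmulq
    rw [W121_j] at h
    exact absurd (norm_j_le_one h11) (not_le.mpr (by exact_mod_cast h))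
  · push Not at h11
    subst h11
    -- `q = 11`: the chosen `ℤ₁₁`-minimal model is `D • W'` with unit `c₄ = D.u⁻¹ ^ 4 * 1936`
    set W' : WeierstrassCurve ℚ_[11] := W121.baseChange ℚ_[11] with hW'
    set Wm : WeierstrassCurve ℚ_[11] := W'.minimal ℤ_[11] with hWm
    have hmul : Wm.HasMultiplicativeReduction ℤ_[11] := hmulq
    haveI : WeierstrassCurve.IsMinimal ℤ_[11] Wm := hmul.toIsMinimal
    obtain ⟨rc, hrc⟩ : ∃ r : ℤ_[11], (r : ℚ_[11]) = Wm.c₄ :=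
      ⟨_, WeierstrassCurve.integralModel_c₄_eq ℤ_[11] Wm⟩
    have hc₄ := hmul.multiplicativeReduction
    rw [← hrc, ← PadicInt.algebraMap_apply, HeightOneSpectrum.valuation_eq_one_iff_notMem] at hc₄
    change rc ∉ IsLocalRing.maximalIdeal ℤ_[11] at hc₄
    rw [IsLocalRing.mem_maximalIdeal, PadicInt.mem_nonunits] at hc₄
    have hc₄' : ‖rc‖ = 1 := le_antisymm (PadicInt.norm_le_one _) (not_lt.mp hc₄)
    have hnorm : ‖Wm.c₄‖ = 1 := by rw [← hrc, ← PadicInt.norm_def, hc₄']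
    -- express `Wm.c₄` through the scaling unit
    set D : WeierstrassCurve.VariableChange ℚ_[11] := (W'.exists_isMinimal ℤ_[11]).choose with hD
    have hWmD : Wm = D • W' := rfl
    have hc4W' : W'.c₄ = (1936 : ℚ_[11]) := by
      rw [hW', WeierstrassCurve.baseChange, WeierstrassCurve.map_c₄, W121_c₄]
      simp
    have hc4m : Wm.c₄ = (↑D.u⁻¹ : ℚ_[11]) ^ 4 * 1936 := by
      rw [hWmD, WeierstrassCurve.variableChange_c₄, hc4W']
    -- norms: ‖u⁻¹‖ = 11 ^ k for an integer k, and ‖1936‖₁₁ = 11⁻²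
    have hu0 : (↑D.u⁻¹ : ℚ_[11]) ≠ 0 := Units.ne_zero _
    have h1936 : ‖(1936 : ℚ_[11])‖ = (11 : ℝ) ^ (-2 : ℤ) := by
      have : ((1936 : ℚ) : ℚ_[11]) = (1936 : ℚ_[11]) := by push_cast; rfl
      rw [← this, Padic.eq_padicNorm]
      have e : (1936 : ℚ) = 16 * (11 * 11) := by norm_num
      rw [e, padicNorm.mul, padicNorm.mul]
      have h16 : padicNorm 11 (16 : ℚ) = 1 := by
        have : ¬ 11 ∣ 16 := by norm_num
        exact_mod_cast (padicNorm.nat_eq_one_iff 16).2 this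
      have h11 : padicNorm 11 (11 : ℚ) = (11 : ℚ)⁻¹ := by
        exact_mod_cast padicNorm.padicNorm_p_of_prime (p := 11)
      rw [h16, h11]
      push_cast
      rw [zpow_neg, zpow_two]
      norm_num
    rw [hc4m, norm_mul, norm_pow, Padic.norm_eq_zpow_neg_valuation hu0, h1936] at hnorm
    have hcast : ((11 : ℕ) : ℝ) = 11 := by norm_num
    rw [hcast] at hnorm
    set k : ℤ := (↑D.u⁻¹ : ℚ_[11]).valuation with hk
    rw [← zpow_natCast, ← zpow_mul, ← zpow_add₀ (by norm_num : (11 : ℝ) ≠ 0)] at hnorm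
    have h1 : (11 : ℝ) ^ (-k * ((4 : ℕ) : ℤ) + -2) = (11 : ℝ) ^ (0 : ℤ) := by rw [hnorm, zpow_zero]
    have h2 := zpow_right_injective₀ (by norm_num : (0 : ℝ) < 11) (by norm_num : (11 : ℝ) ≠ 1) h1
    push_cast at h2
    omega

/-- **Non-vacuity, kernel-checked.** The hypothesis block of the crux `UBPotentiallyGood` is
inhabited: some globally minimal elliptic `W/ℚ` (a global minimal model of `W121`) with NO prime of
multiplicative reduction, and some prime `p ≥ 5` of good ordinary reduction with surjective mod-`p`
Galois representation. [folklore] -/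
theorem hypotheses_inhabited :
    ∃ (W : WeierstrassCurve ℚ) (_ : W.IsElliptic) (_ : W.IsGloballyMinimal),
      (¬ ∃ (q : ℕ) (_ : Fact q.Prime), W.HasMultiplicativeReductionAtPrime q) ∧
      ∃ (p : ℕ) (_ : Fact p.Prime), 5 ≤ p ∧ W.HasGoodReductionAtPrime p ∧
        ¬ (p : ℤ) ∣ W.frobeniusTrace p ∧ W.HasSurjectiveModNGaloisRep p := by
  obtain ⟨C, hC⟩ := WeierstrassCurve.hasGlobalMinimalModel_rat_holds W121
  haveI := hC
  have hj : (C • W121).j = -4096 / 11 := by rw [WeierstrassCurve.variableChange_j, W121_j]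
  have hnCM : ¬ (C • W121).HasCM :=
    (C • W121).not_hasCM_of_one_lt_norm_j (ℓ := 11) (by rw [hj]; exact one_lt_norm_j_eleven)
  have hpg : ¬ ∃ (q : ℕ) (_ : Fact q.Prime), (C • W121).HasMultiplicativeReductionAtPrime q := by
    rintro ⟨q, hq, hm⟩
    exact W121_not_hasMultiplicativeReductionAtPrime q
      ((hasMultiplicativeReductionAtPrime_smul_iff W121 C q).mp hm)
  obtain ⟨p₀, hp₀⟩ := serre_open_image_holds (C • W121) hnCM
  obtain ⟨p, ⟨hp, hgood, hord⟩, hlt⟩ :=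
    (WeierstrassCurve.infinite_goodOrdinaryPrimes_holds (C • W121)).exists_gt (max p₀ 4)
  have h5 : 5 ≤ p := by
    have := le_max_right p₀ 4
    omega
  have hle : p₀ ≤ p := by
    have := le_max_left p₀ 4
    omega
  exact ⟨C • W121, inferInstance, hC, hpg, p, hp, h5, hgood, hord, hp₀ p hp.out hle⟩

/-- The crux is exercised at an honest instance: under `UBPotentiallyGood` the inequality
`corank_p ≤ r_an` holds at some `(W, p)` meeting every hypothesis. [folklore] -/
theorem ub_applies_somewhere (hC : Theses.FrozenTwin.UBPotentiallyGood) :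
    ∃ (W : WeierstrassCurve ℚ) (_ : W.IsElliptic) (p : ℕ) (_ : Fact p.Prime),
      W.selmerCorank p ≤ W.analyticRank := by
  obtain ⟨W, hE, hmin, hpg, p, hp, h5, hgood, hord, hsurj⟩ := hypotheses_inhabited
  exact ⟨W, hE, p, hp, hC W hpg p h5 hgood hord hsurj⟩

#print axioms hypotheses_inhabited

end Summit.BirchSwinnertonDyer.BirchSwinnertonDyer.Cruxes.UBPotentiallyGood.CruxAttack
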